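/-
Origin: expansion seat `planner-pub-hodgecm-pv13-g5-0`, handover #7 2026-08-18T13:5xZ (md5 9dda0526572e7feb34fb3ca060056541; NEW additive leaf; TWO import rewrites by the generic ^import Pv[0-9]+g[0-9]+\. rule: Pv13g5.GenuineSchrodingerSchwartzDense -> HodgeCM.PerL34.GenuineSchrodingerSchwartzDense (my #6 1f97a611) and Pv13g5.GenuineSchrodingerHeisenberg -> HodgeCM.PerL34.GenuineSchrodingerHeisenberg (my #5 3313bc4a); land AFTER both (hence after my #3 and pv07 (`HOME/pub-hodgecm-pv13-g5/lean/Pv13g5/GenuineSchrodingerSchwartzExtend.lean`, md5 9dda0526, 413 lines);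
landed by the gen-8 packager in gate run 30 as `HodgeCM/PerL34/GenuineSchrodingerSchwartzExtend.lean` (import ^import Pv13g5\.GenuineSchrodingerHeisenberg[ \t]*$→import HodgeCM.PerL34.GenuineSchrodingerHeisenberg ×1; import ^import Pv13g5\.GenuineSchrodingerSchwartzDense[ \t]*$→import HodgeCM.PerL34.GenuineSchrodingerSchwartzDense ×1).
-/
/-
# The genuine split Schrödinger model VII: operators and representations given on `𝒮(X)`

Seam S3, 𝓕-side (PerL v5 ll. 259–263: the global Weil representation is *defined* by explicit
formulas on the Schwartz–Bruhat space `𝒮` and extended to the unitary model by density;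
§3(c) ll. 291–314). This file is the kernel EXTENSION PRINCIPLE for the genuine split model
`L²(X)`, `X = ∏'_{v split} ((L⁺_v)³ : 𝒪_v³)` of `GenuineSchrodingerModel` (RUN 29) and its dense
Heisenberg–Levi-stable core `𝒮(X) = Coeff.schwartzBruhat L` (pv07-g5's `GenuineSchrodingerSchwartz`,
identified with print's locally constant compactly supported functions and proved dense in
`GenuineSchrodingerSchwartzDense`):

* §1 `Coeff.extendOp` — a linear endomorphism `T` of `𝒮(X)` preserving the `L²`-norm extends
  UNIQUELY to a bounded operator of `L²(X)`, which is an isometry (`norm_extendOp_apply`,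
  `extendOp_unique`); the extension is multiplicative (`extendOp_one`, `extendOp_mul`).
* §2 `Coeff.extendRep` — a representation `π : K →* End(𝒮(X))` of any group by `L²`-isometric
  automorphisms of `𝒮(X)` extends uniquely to a unitary representation
  `K →* (L²(X) ≃ₗᵢ[ℂ] L²(X))` (`extendRep_apply_coe`, `extendRep_unique`).
* §3 the model's own operators restricted to `𝒮(X)`: `translateS`, `modulateS`, `repS`
  (well defined by the stability theorems of `GenuineSchrodingerSchwartzDense`), and the transfer of
  the Heisenberg relations from `𝒮(X)` to `L²(X)` by density (`extendRep_translate`,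
  `extendRep_modulate`).
* §4 END `Coeff.extendRep_eq_rep_of_heisenberg` / `Coeff.exists_unique_eq_repS_of_heisenberg`:
  **a representation of the split torus `K_split = Model L` on the Schwartz–Bruhat space `𝒮(X)` by
  `L²`-isometric linear automorphisms which satisfies print's Heisenberg relations ON `𝒮(X)`
  (it normalises the translations `τ_y ↦ τ_{k⁻¹y}` and the adelic modulations `M_ξ ↦ M_{k•ξ}` of
  `GenuineSchrodingerHeisenberg`) is the restriction to `𝒮(X)` of `rep L ν` for a UNIQUE character
  `ν : K_split →* S¹`** — i.e. the RUN-29 genuine operators `ν(k) |k|^{1/2} f(k⁻¹x)` are forced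
  already by formulas on Schwartz–Bruhat functions, which is the form in which the Weil
  representation is given in print (Weil 1964 nos. 11–13; MVW ch. 2, II.1–II.6).

Everything is proved in the kernel from the imported files and Mathlib
(`ContinuousLinearMap.extend`, `Continuous.ext_on`); nothing is cited, nothing is posited, and the
file replaces nothing: it is an additive leaf importing `GenuineSchrodingerSchwartzDense` (pv13-g5 #6)
and `GenuineSchrodingerHeisenberg` (pv13-g5 #5). (Compare the tree's abstract shell
`HodgeCM.PerL34.Schur.DenseLift` of `LiftExtension.lean`, which extends a densely defined bounded
INTERTWINER between two given unitary representations; here it is the REPRESENTATION that is given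
on the dense core and extended, and the point is the identification §4 with `rep L ν`.)
-/
import Summits.HodgeConjecture.HodgeCM.PerL34.GenuineSchrodingerSchwartzDense_2
import Summits.HodgeConjecture.HodgeCM.PerL34.GenuineSchrodingerHeisenberg

set_option autoImplicit false

noncomputable section

open MeasureTheory MeasureTheory.Measure Set Metric Function Complex Topology Filter
open scoped RestrictedProduct InnerProductSpace NNReal ENNReal Pointwise

namespace HodgeCM.PerL34.PureTensor.SchrodingerModel

open HodgeCM.PerL34.LocalFactors HodgeCM.PerL34.LocalFactors.DilationModel
open HodgeCM.PerL34.LocalFactors.SchrodingerLevi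
open HodgeCM.PerL34.IdelePlaces HodgeCM.PerL34.IdelicTorusModel HodgeCM.PerL34.IdelicTorusModel.Genuine
open NumberField IsDedekindDomain

attribute [local instance] LocalFactors.DilationModel.Adic.nontriviallyNormedField
  LocalFactors.DilationModel.Adic.properSpace

variable {L : Type} [Field L] [NumberField L] [IsCMField L]

namespace Coeff

/-! ## §1  Extension of norm-preserving endomorphisms of `𝒮(X)` to `L²(X)` -/

/-- two continuous maps out of `L²(X)` agreeing on `𝒮(X)` are equal -/
theorem eq_of_eqOn_schwartzBruhat {Y : Type*} [TopologicalSpace Y] [T2Space Y]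
    {F G : Lp ℂ 2 (μ L) → Y} (hF : Continuous F) (hG : Continuous G)
    (h : ∀ f ∈ schwartzBruhat L, F f = G f) : F = G :=
  Continuous.ext_on dense_schwartzBruhat hF hG fun _ hf => h _ hf

/-- two linear isometric automorphisms of `L²(X)` agreeing on `𝒮(X)` are equal -/
theorem linearIsometryEquiv_eq_of_eqOn_schwartzBruhat {A₁ A₂ : Lp ℂ 2 (μ L) ≃ₗᵢ[ℂ] Lp ℂ 2 (μ L)}
    (h : ∀ f ∈ schwartzBruhat L, A₁ f = A₂ f) : A₁ = A₂ :=
  LinearIsometryEquiv.ext (congrFun (eq_of_eqOn_schwartzBruhat A₁.continuous A₂.continuous h))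

/-- (Ported verbatim from the HodgeCMPerL package; no docstring in the source.) -/
theorem denseRange_subtypeL :
    DenseRange ((schwartzBruhat L).subtypeL : schwartzBruhat L → Lp ℂ 2 (μ L)) := by
  rw [Submodule.coe_subtypeL, Submodule.coe_subtype]
  exact denseRange_subtype_val.2 dense_schwartzBruhat

/-- (Ported verbatim from the HodgeCMPerL package; no docstring in the source.) -/
theorem isUniformInducing_subtypeL :
    IsUniformInducing ((schwartzBruhat L).subtypeL : schwartzBruhat L → Lp ℂ 2 (μ L)) :=
  (schwartzBruhat L).subtypeₗᵢ.isometry.isUniformInducing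

/-- a norm-preserving linear endomorphism of `𝒮(X)`, viewed as a linear isometry into `L²(X)` -/
def toLpIsometry (T : schwartzBruhat L →ₗ[ℂ] schwartzBruhat L) (hT : ∀ f, ‖T f‖ = ‖f‖) :
    schwartzBruhat L →ₗᵢ[ℂ] Lp ℂ 2 (μ L) where
  toLinearMap := (schwartzBruhat L).subtype ∘ₗ T
  norm_map' f := by simpa [Submodule.coe_norm] using hT f

/-- (Ported verbatim from the HodgeCMPerL package; no docstring in the source.) -/
@[simp] theorem toLpIsometry_apply (T : schwartzBruhat L →ₗ[ℂ] schwartzBruhat L)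
    (hT : ∀ f, ‖T f‖ = ‖f‖) (f : schwartzBruhat L) : toLpIsometry T hT f = (T f : Lp ℂ 2 (μ L)) := rfl

/-- **the extension to `L²(X)`** of a norm-preserving linear endomorphism of `𝒮(X)` -/
def extendOp (T : schwartzBruhat L →ₗ[ℂ] schwartzBruhat L) (hT : ∀ f, ‖T f‖ = ‖f‖) :
    Lp ℂ 2 (μ L) →L[ℂ] Lp ℂ 2 (μ L) :=
  (toLpIsometry T hT).toContinuousLinearMap.extend (schwartzBruhat L).subtypeL

section extendOp

variable (T : schwartzBruhat L →ₗ[ℂ] schwartzBruhat L) (hT : ∀ f, ‖T f‖ = ‖f‖)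

/-- the extension agrees with `T` on `𝒮(X)` -/
theorem extendOp_apply_coe (f : schwartzBruhat L) :
    extendOp T hT (f : Lp ℂ 2 (μ L)) = (T f : Lp ℂ 2 (μ L)) :=
  ContinuousLinearMap.extend_eq _ denseRange_subtypeL isUniformInducing_subtypeL f

/-- (Ported verbatim from the HodgeCMPerL package; no docstring in the source.) -/
theorem extendOp_apply_mem {f : Lp ℂ 2 (μ L)} (hf : f ∈ schwartzBruhat L) :
    extendOp T hT f = (T ⟨f, hf⟩ : Lp ℂ 2 (μ L)) :=
  extendOp_apply_coe T hT ⟨f, hf⟩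

/-- the extension preserves `𝒮(X)` -/
theorem extendOp_apply_mem_schwartzBruhat {f : Lp ℂ 2 (μ L)} (hf : f ∈ schwartzBruhat L) :
    extendOp T hT f ∈ schwartzBruhat L := by
  rw [extendOp_apply_mem T hT hf]
  exact (T ⟨f, hf⟩).2

/-- **uniqueness**: a bounded operator agreeing with `T` on `𝒮(X)` is the extension -/
theorem extendOp_unique {A : Lp ℂ 2 (μ L) →L[ℂ] Lp ℂ 2 (μ L)}
    (hA : ∀ f : schwartzBruhat L, A (f : Lp ℂ 2 (μ L)) = (T f : Lp ℂ 2 (μ L))) : A = extendOp T hT :=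
  clm_eq_of_eqOn_schwartzBruhat fun f hf => by rw [extendOp_apply_mem T hT hf]; exact hA ⟨f, hf⟩

/-- **the extension is an isometry** of `L²(X)` -/
theorem norm_extendOp_apply (f : Lp ℂ 2 (μ L)) : ‖extendOp T hT f‖ = ‖f‖ := by
  have hc : IsClosed {g : Lp ℂ 2 (μ L) | ‖extendOp T hT g‖ = ‖g‖} :=
    isClosed_eq (continuous_norm.comp (extendOp T hT).continuous) continuous_norm
  have hsub : (schwartzBruhat L : Set (Lp ℂ 2 (μ L))) ⊆ {g | ‖extendOp T hT g‖ = ‖g‖} := by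
    intro g hg
    show ‖extendOp T hT g‖ = ‖g‖
    rw [extendOp_apply_mem T hT hg]
    exact hT ⟨g, hg⟩
  have hf : f ∈ closure (schwartzBruhat L : Set (Lp ℂ 2 (μ L))) := by
    rw [dense_schwartzBruhat.closure_eq]; exact Set.mem_univ f
  exact hc.closure_subset_iff.2 hsub hf

/-- the extension as a linear isometry -/
def extendIsometry : Lp ℂ 2 (μ L) →ₗᵢ[ℂ] Lp ℂ 2 (μ L) :=
  ⟨(extendOp T hT : Lp ℂ 2 (μ L) →ₗ[ℂ] Lp ℂ 2 (μ L)), norm_extendOp_apply T hT⟩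

/-- (Ported verbatim from the HodgeCMPerL package; no docstring in the source.) -/
@[simp] theorem extendIsometry_apply (f : Lp ℂ 2 (μ L)) :
    extendIsometry T hT f = extendOp T hT f := rfl

end extendOp

/-- proof-irrelevant congruence in `T` -/
theorem extendOp_congr {T T' : schwartzBruhat L →ₗ[ℂ] schwartzBruhat L} (h : T = T')
    (hT : ∀ f, ‖T f‖ = ‖f‖) (hT' : ∀ f, ‖T' f‖ = ‖f‖) : extendOp T hT = extendOp T' hT' := by
  subst h; rfl

/-- **multiplicativity**: the identity of `𝒮(X)` extends to the identity … -/
theorem extendOp_one (h : ∀ f : schwartzBruhat L, ‖(1 : Module.End ℂ (schwartzBruhat L)) f‖ = ‖f‖) :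
    extendOp 1 h = ContinuousLinearMap.id ℂ (Lp ℂ 2 (μ L)) :=
  (extendOp_unique 1 h fun _ => rfl).symm

/-- … and a product to the composite of the extensions -/
theorem extendOp_mul (T T' : schwartzBruhat L →ₗ[ℂ] schwartzBruhat L) (hT : ∀ f, ‖T f‖ = ‖f‖)
    (hT' : ∀ f, ‖T' f‖ = ‖f‖) (h : ∀ f, ‖(T * T') f‖ = ‖f‖) :
    extendOp (T * T') h = (extendOp T hT).comp (extendOp T' hT') := by
  refine (extendOp_unique (T * T') h fun f => ?_).symm
  rw [ContinuousLinearMap.comp_apply, extendOp_apply_coe, extendOp_apply_coe, Module.End.mul_apply]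

/-! ## §2  Extension of representations on `𝒮(X)` by `L²`-isometries -/

section extendRep

variable {K : Type*} [Group K] (π : K →* Module.End ℂ (schwartzBruhat L))
  (hπ : ∀ (k : K) (f : schwartzBruhat L), ‖π k f‖ = ‖f‖)

/-- (Ported verbatim from the HodgeCMPerL package; no docstring in the source.) -/
theorem extendOp_rep_one : extendOp (π 1) (hπ 1) = ContinuousLinearMap.id ℂ (Lp ℂ 2 (μ L)) := by
  rw [extendOp_congr (map_one π) (hπ 1) (fun f => by have h := hπ 1 f; rwa [map_one] at h)]
  exact extendOp_one _

/-- (Ported verbatim from the HodgeCMPerL package; no docstring in the source.) -/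
theorem extendOp_rep_mul (k k' : K) :
    extendOp (π (k * k')) (hπ (k * k')) = (extendOp (π k) (hπ k)).comp (extendOp (π k') (hπ k')) := by
  rw [extendOp_congr (map_mul π k k') (hπ (k * k'))
    (fun f => by rw [← map_mul]; exact hπ (k * k') f)]
  exact extendOp_mul _ _ _ _ _

/-- (Ported verbatim from the HodgeCMPerL package; no docstring in the source.) -/
theorem extendOp_rep_inv_apply (k : K) (f : Lp ℂ 2 (μ L)) :
    extendOp (π k⁻¹) (hπ k⁻¹) (extendOp (π k) (hπ k) f) = f := by
  rw [← ContinuousLinearMap.comp_apply, ← extendOp_rep_mul π hπ, inv_mul_cancel, extendOp_rep_one]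
  rfl

/-- (Ported verbatim from the HodgeCMPerL package; no docstring in the source.) -/
theorem extendOp_rep_apply_inv (k : K) (f : Lp ℂ 2 (μ L)) :
    extendOp (π k) (hπ k) (extendOp (π k⁻¹) (hπ k⁻¹) f) = f := by
  rw [← ContinuousLinearMap.comp_apply, ← extendOp_rep_mul π hπ, mul_inv_cancel, extendOp_rep_one]
  rfl

/-- the unitary operator of `L²(X)` extending `π k` -/
def extendEquiv (k : K) : Lp ℂ 2 (μ L) ≃ₗᵢ[ℂ] Lp ℂ 2 (μ L) where
  toLinearEquiv :=
    (ContinuousLinearEquiv.equivOfInverse (extendOp (π k) (hπ k)) (extendOp (π k⁻¹) (hπ k⁻¹))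
      (extendOp_rep_inv_apply π hπ k) (extendOp_rep_apply_inv π hπ k)).toLinearEquiv
  norm_map' := norm_extendOp_apply (π k) (hπ k)

/-- (Ported verbatim from the HodgeCMPerL package; no docstring in the source.) -/
@[simp] theorem extendEquiv_apply (k : K) (f : Lp ℂ 2 (μ L)) :
    extendEquiv π hπ k f = extendOp (π k) (hπ k) f := rfl

/-- **the unitary representation of `K` on `L²(X)` extending `π`** -/
def extendRep : K →* (Lp ℂ 2 (μ L) ≃ₗᵢ[ℂ] Lp ℂ 2 (μ L)) where
  toFun := extendEquiv π hπ
  map_one' := by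
    refine LinearIsometryEquiv.ext fun f => ?_
    rw [extendEquiv_apply, extendOp_rep_one, LinearIsometryEquiv.coe_one]
    rfl
  map_mul' k k' := by
    refine LinearIsometryEquiv.ext fun f => ?_
    rw [extendEquiv_apply, extendOp_rep_mul, LinearIsometryEquiv.coe_mul]
    rfl

/-- (Ported verbatim from the HodgeCMPerL package; no docstring in the source.) -/
theorem extendRep_apply (k : K) (f : Lp ℂ 2 (μ L)) :
    extendRep π hπ k f = extendOp (π k) (hπ k) f := rfl

/-- `extendRep π` restricts to `π` on `𝒮(X)` … -/
theorem extendRep_apply_coe (k : K) (f : schwartzBruhat L) :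
    extendRep π hπ k (f : Lp ℂ 2 (μ L)) = (π k f : Lp ℂ 2 (μ L)) :=
  extendOp_apply_coe _ _ f

/-- (Ported verbatim from the HodgeCMPerL package; no docstring in the source.) -/
theorem extendRep_apply_mem (k : K) {f : Lp ℂ 2 (μ L)} (hf : f ∈ schwartzBruhat L) :
    extendRep π hπ k f = (π k ⟨f, hf⟩ : Lp ℂ 2 (μ L)) :=
  extendOp_apply_mem _ _ hf

/-- … preserves `𝒮(X)` … -/
theorem extendRep_apply_mem_schwartzBruhat (k : K) {f : Lp ℂ 2 (μ L)} (hf : f ∈ schwartzBruhat L) :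
    extendRep π hπ k f ∈ schwartzBruhat L :=
  extendOp_apply_mem_schwartzBruhat _ _ hf

/-- … and is the ONLY unitary representation of `K` on `L²(X)` doing so -/
theorem extendRep_unique (ρ : K →* (Lp ℂ 2 (μ L) ≃ₗᵢ[ℂ] Lp ℂ 2 (μ L)))
    (hρ : ∀ (k : K) (f : schwartzBruhat L), ρ k (f : Lp ℂ 2 (μ L)) = (π k f : Lp ℂ 2 (μ L))) :
    ρ = extendRep π hπ :=
  MonoidHom.ext fun k => linearIsometryEquiv_eq_of_eqOn_schwartzBruhat fun f hf => by
    rw [extendRep_apply_mem π hπ k hf]; exact hρ k ⟨f, hf⟩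

end extendRep

/-! ## §3  The model's operators on `𝒮(X)` and the transfer of relations by density -/

/-- translation `τ_y` restricted to `𝒮(X)` -/
def translateS (y : Space L) : Module.End ℂ (schwartzBruhat L) :=
  ((translate (μ L) y).toLinearIsometry.toLinearMap).restrict
    fun _ hf => translate_mem_schwartzBruhat y hf

/-- (Ported verbatim from the HodgeCMPerL package; no docstring in the source.) -/
@[simp] theorem coe_translateS_apply (y : Space L) (f : schwartzBruhat L) :
    (translateS y f : Lp ℂ 2 (μ L)) = translate (μ L) y f := rfl

/-- (Ported verbatim from the HodgeCMPerL package; no docstring in the source.) -/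
theorem norm_translateS_apply (y : Space L) (f : schwartzBruhat L) : ‖translateS y f‖ = ‖f‖ :=
  (translate (μ L) y).norm_map (f : Lp ℂ 2 (μ L))

/-- modulation by a continuous additive unitary character of `X`, restricted to `𝒮(X)` -/
def modulateS (χ : C(Space L, Circle)) (hχ : ∀ u v, χ (u + v) = χ u * χ v) :
    Module.End ℂ (schwartzBruhat L) :=
  ((modulate (μ L) χ).toLinearIsometry.toLinearMap).restrict
    fun _ hf => modulate_mem_schwartzBruhat χ hχ hf

/-- (Ported verbatim from the HodgeCMPerL package; no docstring in the source.) -/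
@[simp] theorem coe_modulateS_apply (χ : C(Space L, Circle)) (hχ : ∀ u v, χ (u + v) = χ u * χ v)
    (f : schwartzBruhat L) : (modulateS χ hχ f : Lp ℂ 2 (μ L)) = modulate (μ L) χ f := rfl

/-- (Ported verbatim from the HodgeCMPerL package; no docstring in the source.) -/
theorem norm_modulateS_apply (χ : C(Space L, Circle)) (hχ : ∀ u v, χ (u + v) = χ u * χ v)
    (f : schwartzBruhat L) : ‖modulateS χ hχ f‖ = ‖f‖ :=
  (modulate (μ L) χ).norm_map (f : Lp ℂ 2 (μ L))

/-- the genuine Levi operator `rep L ν k = ν(k) |k|^{1/2} f(k⁻¹ ·)`, restricted to `𝒮(X)` -/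
def repS (ν : Model L →* Circle) (k : Model L) : Module.End ℂ (schwartzBruhat L) :=
  ((rep L ν k).toLinearIsometry.toLinearMap).restrict fun _ hf => rep_mem_schwartzBruhat ν k hf

/-- (Ported verbatim from the HodgeCMPerL package; no docstring in the source.) -/
@[simp] theorem coe_repS_apply (ν : Model L →* Circle) (k : Model L) (f : schwartzBruhat L) :
    (repS ν k f : Lp ℂ 2 (μ L)) = rep L ν k f := rfl

/-- (Ported verbatim from the HodgeCMPerL package; no docstring in the source.) -/
theorem norm_repS_apply (ν : Model L →* Circle) (k : Model L) (f : schwartzBruhat L) :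
    ‖repS ν k f‖ = ‖f‖ :=
  (rep L ν k).norm_map (f : Lp ℂ 2 (μ L))

/-- `k ↦ repS ν k` is a representation of `K_split` on `𝒮(X)` … -/
def repSHom (ν : Model L →* Circle) : Model L →* Module.End ℂ (schwartzBruhat L) where
  toFun := repS ν
  map_one' := by
    refine LinearMap.ext fun f => Subtype.ext ?_
    rw [coe_repS_apply, map_one, LinearIsometryEquiv.coe_one, Module.End.one_apply]
    rfl
  map_mul' k k' := by
    refine LinearMap.ext fun f => Subtype.ext ?_
    rw [coe_repS_apply, map_mul, LinearIsometryEquiv.coe_mul, Module.End.mul_apply, Function.comp_apply,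
      coe_repS_apply, coe_repS_apply]

/-- (Ported verbatim from the HodgeCMPerL package; no docstring in the source.) -/
@[simp] theorem repSHom_apply (ν : Model L →* Circle) (k : Model L) : repSHom ν k = repS ν k := rfl

/-- … whose extension to `L²(X)` is `rep L ν` back -/
theorem extendRep_repSHom (ν : Model L →* Circle) :
    extendRep (repSHom ν) (fun k f => norm_repS_apply ν k f) = rep L ν :=
  (extendRep_unique _ _ (rep L ν) fun _ _ => rfl).symm

section Transfer

variable {K : Type*} [Group K] (π : K →* Module.End ℂ (schwartzBruhat L))
  (hπ : ∀ (k : K) (f : schwartzBruhat L), ‖π k f‖ = ‖f‖)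

/-- **transfer of the translation relation** from `𝒮(X)` to `L²(X)`: if `π k ∘ τ_y = τ_{σ k y} ∘ π k`
on Schwartz–Bruhat vectors then `extendRep π k ∘ τ_y = τ_{σ k y} ∘ extendRep π k` on all of `L²(X)` -/
theorem extendRep_translate (σ : K → Space L → Space L)
    (h : ∀ (k : K) (y : Space L) (f : schwartzBruhat L),
      π k (translateS y f) = translateS (σ k y) (π k f))
    (k : K) (y : Space L) (f : Lp ℂ 2 (μ L)) :
    extendRep π hπ k (translate (μ L) y f) = translate (μ L) (σ k y) (extendRep π hπ k f) := by
  have hc := eq_of_eqOn_schwartzBruhat (Y := Lp ℂ 2 (μ L))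
    ((extendRep π hπ k).continuous.comp (translate (μ L) y).continuous)
    ((translate (μ L) (σ k y)).continuous.comp (extendRep π hπ k).continuous) fun g hg => by
      show extendRep π hπ k (translate (μ L) y g) = translate (μ L) (σ k y) (extendRep π hπ k g)
      rw [extendRep_apply_mem π hπ k hg,
        extendRep_apply_mem π hπ k (translate_mem_schwartzBruhat y hg)]
      exact congrArg Subtype.val (h k y ⟨g, hg⟩)
  exact congrFun hc f

/-- **transfer of the modulation relation**: if `π k ∘ M_χ = M_{χ'} ∘ π k` on `𝒮(X)` for additive
characters `χ, χ'` then the same holds for `extendRep π k` on `L²(X)` -/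
theorem extendRep_modulate (k : K) (χ χ' : C(Space L, Circle)) (hχ : ∀ u v, χ (u + v) = χ u * χ v)
    (hχ' : ∀ u v, χ' (u + v) = χ' u * χ' v)
    (h : ∀ f : schwartzBruhat L, π k (modulateS χ hχ f) = modulateS χ' hχ' (π k f))
    (f : Lp ℂ 2 (μ L)) :
    extendRep π hπ k (modulate (μ L) χ f) = modulate (μ L) χ' (extendRep π hπ k f) := by
  have hc := eq_of_eqOn_schwartzBruhat (Y := Lp ℂ 2 (μ L))
    ((extendRep π hπ k).continuous.comp (modulate (μ L) χ).continuous)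
    ((modulate (μ L) χ').continuous.comp (extendRep π hπ k).continuous) fun g hg => by
      show extendRep π hπ k (modulate (μ L) χ g) = modulate (μ L) χ' (extendRep π hπ k g)
      rw [extendRep_apply_mem π hπ k hg,
        extendRep_apply_mem π hπ k (modulate_mem_schwartzBruhat χ hχ hg)]
      exact congrArg Subtype.val (h ⟨g, hg⟩)
  exact congrFun hc f

end Transfer

/-! ## §4  END: Heisenberg relations on `𝒮(X)` force `rep L ν` -/

section End

variable (ψ : ∀ i : SplitIdx L, AddChar ((basePlaceOf L i.1).adicCompletion (maximalRealSubfield L)) Circle)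
  (hψc : ∀ i, Continuous (ψ i))
  (hψO : ∀ᶠ i : SplitIdx L in cofinite,
    ∀ t : (basePlaceOf L i.1).adicCompletion (maximalRealSubfield L), ‖t‖ ≤ 1 → ψ i t = 1)

/-- the adelic Heisenberg modulation `M_ξ` (`GenuineSchrodingerHeisenberg.heisCharA`) on `𝒮(X)` -/
def heisModS (ξ : Space L) : Module.End ℂ (schwartzBruhat L) :=
  modulateS (heisCharA ψ hψc hψO ξ) (heisCharA_apply_add ψ hψc hψO ξ)

/-- (Ported verbatim from the HodgeCMPerL package; no docstring in the source.) -/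
@[simp] theorem coe_heisModS_apply (ξ : Space L) (f : schwartzBruhat L) :
    (heisModS ψ hψc hψO ξ f : Lp ℂ 2 (μ L)) = modulate (μ L) (heisCharA ψ hψc hψO ξ) f := rfl

/-- the restricted genuine operators DO satisfy print's Heisenberg relations on `𝒮(X)` … -/
theorem repS_translateS (ν : Model L →* Circle) (k : Model L) (y : Space L) (f : schwartzBruhat L) :
    repS ν k (translateS y f) = translateS (k⁻¹ • y) (repS ν k f) :=
  Subtype.ext (rep_translate ν k y f)

/-- (Ported verbatim from the HodgeCMPerL package; no docstring in the source.) -/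
theorem repS_heisModS (ν : Model L →* Circle) (k : Model L) (ξ : Space L) (f : schwartzBruhat L) :
    repS ν k (heisModS ψ hψc hψO ξ f) = heisModS ψ hψc hψO (k • ξ) (repS ν k f) :=
  Subtype.ext (rep_modulate_heisCharA ψ hψc hψO ν k ξ f)


-- port_pkg: scope closed for this part
end End
end Coeff
end HodgeCM.PerL34.PureTensor.SchrodingerModel
end
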